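import Summits.CriticalPhenomena.SAWScalingLimit.Theorems.SAWLeftRightFKGFKGToTraversalBoundSlitNecklaceFarTip
import Summits.CriticalPhenomena.SAWScalingLimit.Theorems.SAWLeftRightFKGFKGToTraversalBoundNecklaceAssemblyFarSelection
import Summits.CriticalPhenomena.SAWScalingLimit.Theorems.SAWLeftRightFKGFKGToTraversalBoundNecklaceAssemblyFarPigeonhole
import HarnessLib

/-!
# Necklace assembly (far-tip form), part 3: the cascade selection for one chord at a fixed mesh

Crux `SAWLeftRightFKG.FKGToTraversalBound` (stmt-CriticalPhenomena-1878), line `slit-necklace`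
(reshape r4), stub `stub_necklaceAssemblyFar`, steps A3–A4 of the chart
`Cruxes/FKGToTraversalBound/Lines/slit-necklace-chart-r4.md` §3 — the DETERMINISTIC part of the assembly,
for ONE chord `γ` of `Ω_δ` at ONE mesh `δ`, with all the cascade data explicit.

Data.  A working shell `D(x; ρ_U, R_U)` whose `δ`-widened closed band is far from both marked centres
(`IsFarPt`, reach `η`); levels `h = 0, …, H` with scales `s h > 0` (`32 δ ≤ s h`, `5 s h + 2 δ ≤ s (h+1) / 4`,
`5 s H + 4 δ ≤ R_U - ρ_U`), finite nets `net h : Fin (N h) → ℂ` of the closed `3`-ball about `x` at mesh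
`s h / 2` (`exists_centre_net`), thresholds `n h`, lower budgets `Wf h` with `N h · (n h + 1) ≤ Wf (h+1) + 1`,
witness budgets `K h`; a GLOBAL rank `rk` of height `≤ H` on start indices of far pieces; and the far-tip
witness of the line (`NecklaceWitnessFar`, in its rank-uniform form) supplied as the hypothesis `hW` for every
ADMISSIBLE centre `c = net h i₁` (`ρ_U + 2 s h ≤ dist c x ≤ R_U - 2 s h`, so that the closed `2 s h`-ball about
`c` lies in the band): a far-tip piece all of whose lower-rank far pieces have at most `Wf h` windows across the
`2δ`-thinned witness shell `D(c; 21 s/16 + 2δ, 27 s/16 - 2δ)` has a far-tip witness with `K h`-bounded windows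
across `D(c; 21 s/16, 27 s/16)` (`s = s h`).

Claim (`necklace_cascadeSelection`).  If a far piece `(i₀, j₀)` of `γ` carries `N H · (n H + 1)` strictly
separated index windows across `D(x; ρ_U + δ, R_U - δ)` strictly inside itself (the third alternative of
`NecklaceBookkeeping`), then for some level `h ≤ H`, some centre `c = net h i₁` and some far-tip piece
`(i, j; τ, τ')` of `γ` with fewer than `M` far-tip pieces starting before it (`M` = the bound on the number of
far pieces), the chord has `n h + 1` strictly separated windows across `D(c; s h, 2 s h)` BETWEEN ITS FAR TIPS
and a far-tip witness with `K h`-bounded windows across `D(c; 21 s h/16, 27 s h/16)` — literally the event of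
`SlotLaw` at `(y, ρ, R, s₁, s₂) := (c, s h, 2 s h, 21 s h/16, 27 s h/16)`.

Proof.  Top: the sub-shell pigeonhole (`hasSepWindows_subshell_pigeonhole`, part 2) puts `n H + 1` of the
windows across an admissible level-`H` shell.  Descent (`necklace_rankDescent`, part 1) on the predicate
"`B h i`: the far piece starting at `i` has `n h + 1` windows across an admissible level-`h` shell" reaches
`(h, i)` with `rk i ≤ h` and no lower-rank far piece satisfying `B (h - 1)`.  At the stop: a window end inside
the inner ball is a far interior vertex, so the piece has far tips (`exists_isFarTipPiece`); a lower-rank far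
piece with `Wf h + 1` windows across the thinned witness shell would have them across the lower-control shell
`D(c; 11 s/8, 13 s/8)` (`HasSepWindows.mono_shell`, `32 δ ≤ s`), hence (pigeonhole again, `5 s (h-1) + 2δ ≤ s/4`)
`n (h-1) + 1` windows across an admissible level-`(h-1)` shell — excluded; so `hW` gives the witness; finally the
windows are trimmed from `(i + 1, j - 1)` to the far tips `(τ, τ')` (`farBand_trim`: tight sub-windows have far
ends, and far interior indices lie between the tips).

Only theorems; axioms are the standard three.
-/

noncomputable section

open Set Metric
open Literature.Probability.LatticeModels
open Literature.Probability.RandomPlanarGeometry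

namespace Summit.CriticalPhenomena.SAWScalingLimit.Theorems.FKGToTraversalBound.SlitNecklace

section Trim

variable {V E : Type*} [PseudoMetricSpace E] {G : SimpleGraph V} {u v : V}

/-- **Window trimming to the far tips.**  If the consecutive vertices of `p` are embedded within `ε₀` of
each other, `(i, j; τ, τ')` is a far-tip piece, every point of the `ε₀`-widened band of `D(y; ρ, R)`
(`ρ < R`) is far, and `p` has `k` strictly separated windows inside `(i + 1, j - 1)` across `D(y; ρ, R)`, then
it has `k` such windows inside `[τ, τ']`: the TIGHT sub-window of each window (`exists_tight_indices`) has both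
ends in the widened band (one step from a vertex strictly inside the band, or from the opposite side), hence
far, and far interior indices of the piece lie between its far tips. [folklore] -/
private theorem farBand_trim (emb : V → E) (p : G.Walk u v) (Sp : Set V) {i j τ τ' k : ℕ}
    {ca cb y : E} {η ρ R ε₀ : ℝ}
    (hstep : ∀ n, dist (emb (p.getVert n)) (emb (p.getVert (n + 1))) ≤ ε₀)
    (hft : IsFarTipPiece emb p Sp i j τ τ' ca cb η)
    (hfar : ∀ z : E, ρ - ε₀ < dist z y → dist z y < R + ε₀ → IsFarPt z ca cb η) (hρR : ρ < R)
    (hw : HasSepWindows emb p k (i + 1) (j - 1) y ρ R) : HasSepWindows emb p k τ τ' y ρ R := by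
  obtain ⟨a, b, hab, hside, hsep⟩ := hw
  set d : ℕ → ℝ := fun n => dist (emb (p.getVert n)) y with hd
  have hε₀ : 0 ≤ ε₀ := le_trans dist_nonneg (hstep 0)
  have hst : ∀ n, d (n + 1) - ε₀ ≤ d n ∧ d n ≤ d (n + 1) + ε₀ := fun n => by
    have h1 := hstep n
    have h2 := dist_triangle (emb (p.getVert n)) (emb (p.getVert (n + 1))) y
    have h3 := dist_triangle (emb (p.getVert (n + 1))) (emb (p.getVert n)) y
    have h4 := dist_comm (emb (p.getVert (n + 1))) (emb (p.getVert n))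
    simp only [hd]
    constructor <;> linarith
  -- tight sub-windows
  choose a' b' ha' ha'b' hb' hside' hint using
    fun m => ExcursionDomination.ShellIteration.exists_tight_indices (d := d) hρR (hab m).2.1 (hside m)
  -- both ends of a tight window lie in the widened band
  have hband : ∀ m, (ρ - ε₀ < d (a' m) ∧ d (a' m) < R + ε₀) ∧ (ρ - ε₀ < d (b' m) ∧ d (b' m) < R + ε₀) := by
    intro m
    have hlt := ha'b' m
    -- the neighbours `a' m + 1` and `b' m - 1` inside the window
    have hnext : ρ < d (a' m + 1) ∧ d (a' m + 1) < R ∨ a' m + 1 = b' m := by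
      by_cases h : a' m + 1 < b' m
      · exact Or.inl (hint m _ (Nat.lt_succ_self _) h)
      · exact Or.inr (by omega)
    have hprev : ρ < d (b' m - 1) ∧ d (b' m - 1) < R ∨ b' m - 1 = a' m := by
      by_cases h : a' m < b' m - 1
      · exact Or.inl (hint m _ h (by omega))
      · exact Or.inr (by omega)
    have hs1 := hst (a' m)
    have hs2 := hst (b' m - 1)
    rw [Nat.sub_add_cancel (by omega : 1 ≤ b' m)] at hs2
    rcases hside' m with ⟨h1, h2⟩ | ⟨h1, h2⟩
    · refine ⟨⟨?_, by linarith⟩, by linarith, ?_⟩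
      · rcases hnext with h | h
        · linarith [h.1]
        · rw [h] at hs1; linarith
      · rcases hprev with h | h
        · linarith [h.2]
        · rw [h] at hs2; linarith
    · refine ⟨⟨by linarith, ?_⟩, ?_, by linarith⟩
      · rcases hnext with h | h
        · linarith [h.2]
        · rw [h] at hs1; linarith
      · rcases hprev with h | h
        · linarith [h.1]
        · rw [h] at hs2; linarith
  -- far interior indices lie between the far tips
  obtain ⟨hpc, hiτ, hττ', hτ'j, -, -, hnearL, hnearR⟩ := hft
  have hmid : ∀ n, i < n → n < j → IsFarPt (emb (p.getVert n)) ca cb η → τ ≤ n ∧ n ≤ τ' := by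
    intro n hin hnj hf
    constructor
    · by_contra hlt
      exact hnearL n hin (not_le.1 hlt) hf
    · by_contra hlt
      exact hnearR n (not_le.1 hlt) hnj hf
  have hij := hpc.2.2.1
  refine ⟨a', b', fun m => ?_, hside', fun m m' hmm' => ?_⟩
  · have h1 := hab m
    have h2 := ha' m
    have h3 := hb' m
    have h4 := ha'b' m
    have hfa : IsFarPt (emb (p.getVert (a' m))) ca cb η := hfar _ (hband m).1.1 (hband m).1.2
    have hfb : IsFarPt (emb (p.getVert (b' m))) ca cb η := hfar _ (hband m).2.1 (hband m).2.2
    have hma := hmid (a' m) (by omega) (by omega) hfa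
    have hmb := hmid (b' m) (by omega) (by omega) hfb
    exact ⟨hma.1, h4.le, hmb.2⟩
  · calc b' m ≤ b m := hb' m
      _ < a m' := hsep hmm'
      _ ≤ a' m' := ha' m'

end Trim

/-- Consecutive vertices of a walk of `Ω_δ` (`δ ≥ 0`) have mesh points within `δ` of each other (also past the
end of the walk, where `getVert` is constant). [folklore] -/
private theorem step_le_mesh {Ω : Set ℂ} {δ : ℝ} (hδ : 0 ≤ δ) {a₀ b₀ : Site 2}
    (γ : (discreteDomainGraph Ω δ).Walk a₀ b₀) (n : ℕ) :
    dist (meshPoint δ (γ.getVert n)) (meshPoint δ (γ.getVert (n + 1))) ≤ δ := by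
  by_cases hn : n < γ.length
  · exact ExcursionDomination.ShellIteration.dist_meshPoint_le_of_le_zdGraph
      ((discreteDomainGraph_le_meshGraph Ω δ).trans (meshGraph_le_zdGraph Ω δ)) hδ (γ.adj_getVert_succ hn)
  · rw [γ.getVert_of_length_le (not_lt.1 hn), γ.getVert_of_length_le (by omega), dist_self]
    exact hδ

/-- **Registered part of `stub_necklaceAssemblyFar`: the cascade selection** (chart r4 §3, A3–A4, for one chord
at a fixed mesh, all cascade data explicit; see the module docstring for the list of hypotheses).  From a far
piece overloaded across the working shell to a level `h ≤ H`, an admissible centre `c = net h i₁` and a far-tip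
piece `(i, j; τ, τ')` with fewer than `M` earlier far-tip pieces, `n h + 1` strictly separated windows across
`D(c; s h, 2 s h)` between its far tips, and a far-tip witness with `K h`-bounded windows across
`D(c; 21 s h / 16, 27 s h / 16)`. [folklore] -/
theorem necklace_cascadeSelection : ∀ (Ω : Set ℂ) (δ : ℝ) (a₀ b₀ : Site 2)
    (γ : (discreteDomainGraph Ω δ).Walk a₀ b₀) (Sp S' : Set (Site 2)) (ca cb x : ℂ) (η ρU RU : ℝ) (H M : ℕ)
    (s : ℕ → ℝ) (N : ℕ → ℕ) (net : (h : ℕ) → Fin (N h) → ℂ) (n Wf K rk : ℕ → ℕ) (i₀ j₀ : ℕ),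
    0 < δ → RU ≤ 3 → 0 ≤ ρU →
    (∀ z : ℂ, ρU - δ ≤ dist z x → dist z x ≤ RU + δ → IsFarPt z ca cb η) →
    (∀ h, h ≤ H → 0 < s h) → (∀ h, h ≤ H → 32 * δ ≤ s h) →
    (∀ h, h < H → 5 * s h + 2 * δ ≤ s (h + 1) / 4) → 5 * s H + 4 * δ ≤ RU - ρU →
    (∀ h, h ≤ H → ∀ m : ℂ, dist m x ≤ 3 → ∃ i : Fin (N h), dist m (net h i) ≤ s h / 2) →
    (∀ h, h < H → N h * (n h + 1) ≤ Wf (h + 1) + 1) →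
    (∀ i, rk i ≤ H) →
    {i : ℕ | ∃ j, IsFarPiece (meshPoint δ) γ Sp S' i j ca cb η}.ncard < M →
    (∀ (h : ℕ) (i₁ : Fin (N h)) (i j τ τ' : ℕ), h ≤ H →
      ρU + 2 * s h ≤ dist (net h i₁) x → dist (net h i₁) x ≤ RU - 2 * s h →
      IsFarTipPiece (meshPoint δ) γ Sp i j τ τ' ca cb η →
      (∀ i' j', IsFarPiece (meshPoint δ) γ Sp S' i' j' ca cb η → rk i' < rk i →
        ¬ HasSepWindows (meshPoint δ) γ (Wf h + 1) (i' + 1) (j' - 1) (net h i₁)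
          (21 * s h / 16 + 2 * δ) (27 * s h / 16 - 2 * δ)) →
      HasFarTipWitness Ω δ Sp γ τ τ' (K h) (net h i₁) (21 * s h / 16) (27 * s h / 16)) →
    IsFarPiece (meshPoint δ) γ Sp S' i₀ j₀ ca cb η →
    HasSepWindows (meshPoint δ) γ (N H * (n H + 1)) (i₀ + 1) (j₀ - 1) x (ρU + δ) (RU - δ) →
    ∃ (h : ℕ) (i₁ : Fin (N h)) (i j τ τ' : ℕ), h ≤ H ∧
      IsFarTipPiece (meshPoint δ) γ Sp i j τ τ' ca cb η ∧
      {i' : ℕ | i' < i ∧ ∃ j' τ₁ τ₁', IsFarTipPiece (meshPoint δ) γ Sp i' j' τ₁ τ₁' ca cb η}.ncard < M ∧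
      HasSepWindows (meshPoint δ) γ (n h + 1) τ τ' (net h i₁) (s h) (2 * s h) ∧
      HasFarTipWitness Ω δ Sp γ τ τ' (K h) (net h i₁) (21 * s h / 16) (27 * s h / 16) := by
  intro Ω δ a₀ b₀ γ Sp S' ca cb x η ρU RU H M s N net n Wf K rk i₀ j₀ hδ hRU hρU hfar hs hs32 hscale hsH
    hnet hWf hrk hM hW hfar₀ hwin₀
  have hstep := step_le_mesh hδ.le γ
  -- admissibility of a centre at level `h`
  set Adm : ℕ → ℂ → Prop := fun h c => ρU + 2 * s h ≤ dist c x ∧ dist c x ≤ RU - 2 * s h with hAdm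
  -- the level predicate of the descent
  set B : ℕ → ℕ → Prop := fun h i => ∃ i₁ : Fin (N h), Adm h (net h i₁) ∧ ∃ j,
    IsFarPiece (meshPoint δ) γ Sp S' i j ca cb η ∧
      HasSepWindows (meshPoint δ) γ (n h + 1) (i + 1) (j - 1) (net h i₁) (s h) (2 * s h) with hB
  -- top: pigeonhole into the level-`H` family
  have hBtop : B H i₀ := by
    obtain ⟨i₁, hloc₁, hloc₂, hw⟩ := hasSepWindows_subshell_pigeonhole (meshPoint δ) γ δ x (ρU + δ) (RU - δ)
      (s H) (n H + 1) (i₀ + 1) (j₀ - 1) (net H) hstep (by linarith) (hs H le_rfl) (by linarith)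
      (Nat.succ_pos _) (fun m hm => hnet H le_rfl m (by linarith)) hwin₀
    refine ⟨i₁, ⟨?_, ?_⟩, j₀, hfar₀, hw⟩
    · have := hs H le_rfl
      linarith
    · have := hs H le_rfl
      linarith
  -- descent
  obtain ⟨h, i, hhH, hrki, hBi, hmin⟩ := necklace_rankDescent rk B H i₀ (hrk i₀) hBtop
  obtain ⟨i₁, hadm, j, hfp, hw⟩ := hBi
  have hsh := hs h hhH
  have hs32h := hs32 h hhH
  -- the piece has a far interior vertex: a window end inside the inner ball
  have hft : ∃ τ τ', IsFarTipPiece (meshPoint δ) γ Sp i j τ τ' ca cb η := by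
    refine exists_isFarTipPiece hfp.1 ?_
    obtain ⟨a, b, hab, hside, -⟩ := hw
    have hij := hfp.1.2.2.1
    have m₀ : Fin (n h + 1) := ⟨0, Nat.succ_pos _⟩
    have hnear : ∀ e, dist (meshPoint δ (γ.getVert e)) (net h i₁) ≤ s h →
        IsFarPt (meshPoint δ (γ.getVert e)) ca cb η := fun e he => by
      have h1 := dist_triangle (meshPoint δ (γ.getVert e)) (net h i₁) x
      have h2 := dist_triangle (net h i₁) (meshPoint δ (γ.getVert e)) x
      rw [dist_comm (net h i₁) (meshPoint δ (γ.getVert e))] at h2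
      exact hfar _ (by linarith [hadm.1]) (by linarith [hadm.2])
    rcases hside m₀ with ⟨h1, -⟩ | ⟨-, h1⟩
    · exact ⟨a m₀, by have := hab m₀; omega, by have := hab m₀; omega, hnear _ h1⟩
    · exact ⟨b m₀, by have := hab m₀; omega, by have := hab m₀; omega, hnear _ h1⟩
  obtain ⟨τ, τ', hft⟩ := hft
  -- lower-rank far pieces are controlled across the thinned witness shell
  have hlow : ∀ i' j', IsFarPiece (meshPoint δ) γ Sp S' i' j' ca cb η → rk i' < rk i →
      ¬ HasSepWindows (meshPoint δ) γ (Wf h + 1) (i' + 1) (j' - 1) (net h i₁)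
        (21 * s h / 16 + 2 * δ) (27 * s h / 16 - 2 * δ) := by
    intro i' j' hfp' hrk' hw'
    rcases Nat.eq_zero_or_pos h with rfl | hpos
    · omega
    · obtain ⟨h₀, rfl⟩ : ∃ h₀, h = h₀ + 1 := ⟨h - 1, by omega⟩
      have hh₀ : h₀ < H := by omega
      -- across the lower-control shell `D(c; 11 s/8, 13 s/8)`, then pigeonhole into level `h₀`
      have hw'' : HasSepWindows (meshPoint δ) γ (N h₀ * (n h₀ + 1)) (i' + 1) (j' - 1) (net (h₀ + 1) i₁)
          (11 * s (h₀ + 1) / 8) (13 * s (h₀ + 1) / 8) :=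
        (hw'.mono_shell (by linarith) (by linarith)).of_le (hWf h₀ hh₀)
      obtain ⟨i₂, hloc₁, hloc₂, hw₃⟩ := hasSepWindows_subshell_pigeonhole (meshPoint δ) γ δ (net (h₀ + 1) i₁)
        (11 * s (h₀ + 1) / 8) (13 * s (h₀ + 1) / 8) (s h₀) (n h₀ + 1) (i' + 1) (j' - 1) (net h₀) hstep
        (by linarith) (hs h₀ hh₀.le) (by linarith [hscale h₀ hh₀]) (Nat.succ_pos _)
        (fun m hm => hnet h₀ hh₀.le m (by linarith [dist_triangle m (net (h₀ + 1) i₁) x, hadm.2])) hw''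
      refine hmin i' hrk' ?_
      rw [Nat.add_sub_cancel]
      refine ⟨i₂, ⟨?_, ?_⟩, j', hfp', hw₃⟩
      · have h1 := dist_triangle (net (h₀ + 1) i₁) (net h₀ i₂) x
        rw [dist_comm (net (h₀ + 1) i₁) (net h₀ i₂)] at h1
        linarith [hscale h₀ hh₀, hadm.1]
      · have h1 := dist_triangle (net h₀ i₂) (net (h₀ + 1) i₁) x
        linarith [hscale h₀ hh₀, hadm.2]
  have hwit := hW h i₁ i j τ τ' hhH hadm.1 hadm.2 hft hlow
  -- trim the windows to the far tips
  have htrim : HasSepWindows (meshPoint δ) γ (n h + 1) τ τ' (net h i₁) (s h) (2 * s h) := by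
    refine farBand_trim (meshPoint δ) γ Sp hstep hft (fun z hz₁ hz₂ => ?_) (by linarith) hw
    have h1 := dist_triangle z (net h i₁) x
    have h2 := dist_triangle (net h i₁) z x
    rw [dist_comm (net h i₁) z] at h2
    exact hfar z (by linarith [hadm.1]) (by linarith [hadm.2])
  -- the earlier far-tip pieces are far pieces
  have hJ : {i' : ℕ | i' < i ∧ ∃ j' τ₁ τ₁', IsFarTipPiece (meshPoint δ) γ Sp i' j' τ₁ τ₁' ca cb η}.ncard < M := by
    refine lt_of_le_of_lt (Set.ncard_le_ncard (fun i' hi' => ?_) ?_) hM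
    · obtain ⟨-, j', τ₁, τ₁', hft'⟩ := hi'
      exact ⟨j', hft'.isFarPiece S'⟩
    · refine (Set.finite_Iic γ.length).subset fun i' hi' => ?_
      obtain ⟨j', hfp'⟩ := hi'
      exact hfp'.1.1.1
  exact ⟨h, i₁, i, j, τ, τ', hhH, hft, hJ, htrim, hwit⟩

end Summit.CriticalPhenomena.SAWScalingLimit.Theorems.FKGToTraversalBound.SlitNecklace

end
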